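import Summits.KontsevichZagierPeriods.KontsevichZagierPeriods.Theorems.IsogenyCertificatesXMapKernelStubEtaIndependenceNonCMAux

/-!
# `XMapKernel`, line `derived-datum-quasi-periods` — stub `stub_etaIndependence`: class independence,
# the non-CM case (discharge of the non-CM half of hypothesis (2) of `stub_etaIndependence_of`)

Support file for the crux `IsogenyCertificates.XMapKernel` (stmt-KontsevichZagierPeriods-10663),
line `derived-datum-quasi-periods`, stub `stub_etaIndependence`. Its conditional form
`stub_etaIndependence_of` (file `…StubEtaIndependence.lean`) takes as hypothesis (2) CLASS
INDEPENDENCE: for finitely many pairwise isogenous lattices `Λⱼ` with rational invariants and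
pairwise without rational multiplier, non-zero real lattice vectors `Ωⱼ = aⱼω₁ + bⱼω₂ ∈ Λⱼ` and
their quasi-periods `Hⱼ = aⱼη₁ + bⱼη₂` are `ℚ`-linearly independent. THIS FILE PROVES IT WHEN THE
CLASS HAS NO COMPLEX MULTIPLICATION (`classIndependence_nonCM`), and reduces (2) to its CM case
(`classIndependence_of_cm`).

**Proof (non-CM).** Fix `Λ₀ = Λ_{i₀}` (no CM), `u = Ω₀(Λ₀)`, `v = Ω₀(iΛ₀)`. Multipliers
`αⱼΛ₀ ⊆ Λⱼ` have certificates (`stub_nonCMClass_certificate`): `αⱼ = tⱼ` or `tⱼi`, `tⱼ² ∈ ℚ`,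
`NⱼΛⱼ ⊆ αⱼΛ₀`, `Ω₀(Λⱼ) = xⱼu` resp. `xⱼv`, `xⱼ = (mⱼ/Nⱼ)tⱼ > 0`; so `Ωⱼ = κⱼxⱼu` resp. `κⱼxⱼv`,
`κⱼ ∈ ℤ ∖ 0`. Quasi-period transport along `βⱼ = Nⱼ/αⱼ : Λⱼ → Λ₀`
(`IsotypicSplitting.quasiPeriod_transport`) gives `N'ⱼHⱼ = βⱼη₀(βⱼΩⱼ) − sⱼΩⱼ`, `sⱼ ∈ ℚ̄`, with
`βⱼΩⱼ = κⱼmⱼu` resp. `−κⱼmⱼiv`, i.e. `N'ⱼHⱼ = (κⱼmⱼ²/xⱼ)η(u) − sⱼΩⱼ` resp.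
`(κⱼmⱼ²/xⱼ)iη(iv) − sⱼΩⱼ`. The relation becomes `A_re u + A_im v + C_re η(u) + C_im iη(iv) = 0`
with algebraic brackets, all zero by `indep_four` (Masser II); `C_re = ∑ (qⱼκⱼmⱼ²/N'ⱼ)xⱼ⁻¹ = 0`
with pairwise irrational `xⱼ/xⱼ'` (else a rational multiplier) forces `qⱼ = 0`
(`radical_indep_finset`), then `A_re = ∑ pⱼκⱼxⱼ = 0` forces `pⱼ = 0`; same for the other type.

References: Masser, LNM 437 (1975), Ch. II Thm. II, Ch. III Lemma 3.1; Lawden (1989) §9.8;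
Cox, *Primes of the form x² + ny²*, §10.C; Mordell, Pacific J. Math. 3 (1953).
-/

noncomputable section

namespace Summit.KontsevichZagierPeriods.IsogenyCertificates.XMapKernelStubs.EtaIndependence

open scoped BigOperators ComplexConjugate
open Complex Literature.NumberTheory.Transcendental

/-- **Class independence, non-CM case.** For finitely many lattices `Λⱼ` (`j ∈ S`) with rational
invariants, pairwise isogenous, pairwise without rational multiplier, one of which (`Λ_{i₀}`) has no
complex multiplication, and non-zero real lattice vectors `Ωⱼ = aⱼω₁ + bⱼω₂ ∈ Λⱼ`: a vanishing
`ℚ`-combination `∑ⱼ (pⱼΩⱼ + qⱼ(aⱼη₁ + bⱼη₂)) = 0` is trivial. Proof in the module docstring.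
[cite: Masser1975, Ch. II Thm. II and Ch. III Lemma 3.1] -/
theorem classIndependence_nonCM : ∀ (k : ℕ) (S : Finset (Fin k)) (L : Fin k → PeriodPair) (a b : Fin k → ℤ) (p q : Fin k → ℚ) (i₀ : Fin k), i₀ ∈ S → ¬ (L i₀).HasCM → (∀ j ∈ S, (∃ r : ℚ, (r : ℂ) = (L j).g₂) ∧ (∃ r : ℚ, (r : ℂ) = (L j).g₃)) → (∀ j ∈ S, ((a j : ℂ) * (L j).ω₁ + (b j : ℂ) * (L j).ω₂).im = 0 ∧ (a j : ℂ) * (L j).ω₁ + (b j : ℂ) * (L j).ω₂ ≠ 0) → (∀ i ∈ S, ∀ j ∈ S, (L i).IsIsogenousTo (L j)) → (∀ i ∈ S, ∀ j ∈ S, i ≠ j → ¬ ∃ c : ℚ, c ≠ 0 ∧ ∀ l ∈ (L i).lattice, (c : ℂ) * l ∈ (L j).lattice) → ∑ j ∈ S, ((p j : ℂ) * ((a j : ℂ) * (L j).ω₁ + (b j : ℂ) * (L j).ω₂) + (q j : ℂ) * ((a j : ℂ) * (L j).η₁ + (b j : ℂ) * (L j).η₂)) = 0 → ∀ j ∈ S,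 p j = 0 ∧ q j = 0 := by
  intro k S L a b p q i₀ hi₀ hCM hrat hper hiso hnrm hsum
  classical
  -- (0) realness and algebraicity of the invariants
  have hLreal : ∀ j ∈ S, (L j).IsReal := fun j hj => by
    obtain ⟨⟨r₂, hr₂⟩, ⟨r₃, hr₃⟩⟩ := hrat j hj
    exact PeriodPair.isReal_of_g₂_g₃_real PeriodPair.uniformization_unique_holds
      (by rw [← hr₂]; exact ratCast_im r₂) (by rw [← hr₃]; exact ratCast_im r₃)
  have hLalg : ∀ j ∈ S, IsAlgebraic ℚ (L j).g₂ ∧ IsAlgebraic ℚ (L j).g₃ := fun j hj => by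
    obtain ⟨⟨r₂, hr₂⟩, ⟨r₃, hr₃⟩⟩ := hrat j hj
    exact ⟨by rw [← hr₂]; exact isAlgebraic_algebraMap r₂, by rw [← hr₃]; exact isAlgebraic_algebraMap r₃⟩
  set L₀ : PeriodPair := L i₀ with hL₀
  have hg₂ : ∃ r : ℚ, (r : ℂ) = L₀.g₂ := (hrat i₀ hi₀).1
  have hg₃ : ∃ r : ℚ, (r : ℂ) = L₀.g₃ := (hrat i₀ hi₀).2
  have hreal₀ : L₀.IsReal := hLreal i₀ hi₀
  have hu : 0 < L₀.minRealPeriod := hreal₀.minRealPeriod_pos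
  have hv : 0 < (L₀.mulLeft I I_ne_zero).minRealPeriod := hreal₀.mulLeft_I.minRealPeriod_pos
  -- coordinates of `u` and `iv` in the basis of `Λ₀`
  have humem : ((L₀.minRealPeriod : ℝ) : ℂ) ∈ L₀.lattice := hreal₀.minRealPeriod_mem_lattice
  have hvmem : I * ((L₀.mulLeft I I_ne_zero).minRealPeriod : ℂ) ∈ L₀.lattice := by
    have h1 := hreal₀.mulLeft_I.minRealPeriod_mem_lattice
    rw [PeriodPair.mem_mulLeft_lattice, inv_I, neg_mul] at h1
    simpa using neg_mem h1
  obtain ⟨m₁, n₁, e₁⟩ := PeriodPair.mem_lattice.1 humem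
  obtain ⟨m₂, n₂, e₂⟩ := PeriodPair.mem_lattice.1 hvmem
  -- (1) the multipliers `αⱼΛ₀ ⊆ Λⱼ` and their rigidity
  have hmem' : ∀ j ∈ S, ∃ α : ℂ, α ≠ 0 ∧ ∀ l ∈ L₀.lattice, α * l ∈ (L j).lattice :=
    fun j hj => hiso i₀ hi₀ j hj
  choose! α hα0 hαL using hmem'
  have hRig' : ∀ j ∈ S, ∀ (γ : ℂ) (σ : ℂ ≃+* ℂ), γ ≠ 0 →
      (∀ l ∈ L₀.lattice, γ * l ∈ (L j).lattice) → ∀ l ∈ L₀.lattice, σ γ * l ∈ (L j).lattice :=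
    fun j hj γ σ hγ hγL =>
      MultiplierRigidity.stub_multiplierRigidity L₀ (L j) γ σ hg₂ hg₃ (hrat j hj).1 (hrat j hj).2
        hγ hγL
  -- (2) the certificates of the multipliers
  have hcert : ∀ j ∈ S, ∃ (N : ℕ) (t : ℝ) (e : ℚ) (m : ℤ), N ≠ 0 ∧ t ≠ 0 ∧ t ^ 2 = (e : ℝ) ∧
      (∀ y ∈ (L j).lattice, (N : ℂ) * ((α j)⁻¹ * y) ∈ L₀.lattice) ∧
      (((α j).im = 0 ∧ α j = t ∧ (L j).minRealPeriod = m / N * t * L₀.minRealPeriod) ∨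
        ((α j).im ≠ 0 ∧ α j = t * I ∧
          (L j).minRealPeriod = m / N * t * (L₀.mulLeft I I_ne_zero).minRealPeriod)) :=
    fun j hj =>
      NonCMClass.stub_nonCMClass_certificate L₀ (L j) (hRig' j hj) hCM hreal₀ (hLreal j hj) (α j)
        (hα0 j hj) (hαL j hj)
  choose! N t e m hN ht hte hNL hcase using hcert
  obtain ⟨x, hx⟩ : ∃ x : Fin k → ℝ, ∀ j, x j = (m j : ℝ) / N j * t j := ⟨_, fun j => rfl⟩
  obtain ⟨g, hg⟩ : ∃ g : Fin k → ℝ, ∀ j,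
      g j = if (α j).im = 0 then L₀.minRealPeriod else (L₀.mulLeft I I_ne_zero).minRealPeriod :=
    ⟨_, fun j => rfl⟩
  obtain ⟨G, hG⟩ : ∃ G : Fin k → ℂ, ∀ j,
      G j = if (α j).im = 0 then ((m₁ : ℂ) * L₀.η₁ + n₁ * L₀.η₂)
        else I * ((m₂ : ℂ) * L₀.η₁ + n₂ * L₀.η₂) := ⟨_, fun j => rfl⟩
  have hgpos : ∀ j, 0 < g j := fun j => by rw [hg]; split_ifs; exacts [hu, hv]
  have hw : ∀ j ∈ S, (L j).minRealPeriod = x j * g j := by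
    intro j hj
    rcases hcase j hj with ⟨hp, -, hwj⟩ | ⟨hp, -, hwj⟩
    · rw [hwj, hx, hg, if_pos hp]
    · rw [hwj, hx, hg, if_neg hp]
  have hxpos : ∀ j ∈ S, 0 < x j := fun j hj => by
    have h1 := (hLreal j hj).minRealPeriod_pos
    rw [hw j hj] at h1
    exact pos_of_mul_pos_left h1 (hgpos j).le
  have hm0 : ∀ j ∈ S, m j ≠ 0 := by
    intro j hj h0
    have := hxpos j hj
    rw [hx, h0, Int.cast_zero, zero_div, zero_mul] at this
    exact lt_irrefl _ this
  have hxsq : ∀ j ∈ S, ∃ a : ℚ, x j ^ 2 = (a : ℝ) := fun j hj =>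
    ⟨((m j : ℚ) / N j) ^ 2 * e j, by rw [hx]; push_cast; rw [← hte j hj]; ring⟩
  have hxalg : ∀ j ∈ S, IsAlgebraic ℚ (x j : ℂ) := by
    intro j hj
    obtain ⟨a', ha'⟩ := hxsq j hj
    refine IsAlgebraic.of_pow (n := 2) (by norm_num) ?_
    have h1 : (x j : ℂ) ^ 2 = (a' : ℂ) := by
      rw [← ofReal_ratCast]
      exact_mod_cast congrArg ((↑) : ℝ → ℂ) ha'
    rw [h1]
    exact isAlgebraic_algebraMap a'
  -- (3) within one type the `xⱼ` have pairwise irrational ratios (no rational multiplier)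
  have hirr : ∀ j ∈ S, ∀ j' ∈ S, j ≠ j' → ((α j).im = 0 ↔ (α j').im = 0) →
      ¬ ∃ r : ℚ, x j = (r : ℝ) * x j' := by
    rintro j hj j' hj' hne hξξ ⟨r, hr⟩
    have hmj : (m j : ℝ) ≠ 0 := by exact_mod_cast hm0 j hj
    have hNj : (N j : ℝ) ≠ 0 := by exact_mod_cast hN j hj
    have htt : t j = ((r * ((m j' : ℚ) / N j') * ((N j : ℚ) / m j) : ℚ) : ℝ) * t j' := by
      have e1 : t j = (N j : ℝ) / m j * ((m j : ℝ) / N j * t j) := by field_simp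
      rw [e1, ← hx, hr, hx]
      push_cast
      ring
    set r' : ℚ := r * ((m j' : ℚ) / N j') * ((N j : ℚ) / m j) with hr'_def
    have hr'0 : r' ≠ 0 := by
      intro h0
      apply ht j hj
      rw [htt, h0, Rat.cast_zero, zero_mul]
    have hαα : α j = (r' : ℂ) * α j' := by
      rcases hcase j hj with ⟨hp, hαj, -⟩ | ⟨hp, hαj, -⟩
      · have hp' : (α j').im = 0 := hξξ.1 hp
        rcases hcase j' hj' with ⟨-, hαj', -⟩ | ⟨hp'', -, -⟩
        · rw [hαj, hαj', htt]; push_cast; ring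
        · exact absurd hp' hp''
      · rcases hcase j' hj' with ⟨hp'', -, -⟩ | ⟨-, hαj', -⟩
        · exact absurd (hξξ.2 hp'') hp
        · rw [hαj, hαj', htt]; push_cast; ring
    refine hnrm j' hj' j hj hne.symm ⟨(N j' : ℚ) * r',
      mul_ne_zero (by exact_mod_cast hN j' hj') hr'0, fun l hl => ?_⟩
    have h2 := hαL j hj _ (hNL j' hj' l hl)
    have e2 : (((N j' : ℚ) * r' : ℚ) : ℂ) * l = α j * ((N j' : ℂ) * ((α j')⁻¹ * l)) := by
      rw [hαα]
      push_cast
      field_simp [hα0 j' hj']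
    rw [e2]
    exact h2
  -- (4) the given real periods: `Ωⱼ = κⱼ·Ω₀(Λⱼ) = κⱼxⱼgⱼ`, `κⱼ ∈ ℤ ∖ 0`
  have hκ : ∀ j ∈ S, ∃ κ : ℤ, κ ≠ 0 ∧
      (a j : ℂ) * (L j).ω₁ + (b j : ℂ) * (L j).ω₂ = (κ : ℂ) * ((x j : ℂ) * (g j : ℂ)) := by
    intro j hj
    obtain ⟨him, hne⟩ := hper j hj
    have hΩre : ((((a j : ℂ) * (L j).ω₁ + (b j : ℂ) * (L j).ω₂).re : ℝ) : ℂ) =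
        (a j : ℂ) * (L j).ω₁ + (b j : ℂ) * (L j).ω₂ := Complex.ext (by simp) (by simp [him])
    have hmemΩ : ((((a j : ℂ) * (L j).ω₁ + (b j : ℂ) * (L j).ω₂).re : ℝ) : ℂ) ∈ (L j).lattice := by
      rw [hΩre]
      exact PeriodPair.mem_lattice.2 ⟨a j, b j, rfl⟩
    obtain ⟨κ, hκ⟩ := (hLreal j hj).exists_eq_int_mul hmemΩ
    refine ⟨κ, ?_, ?_⟩
    · rintro rfl
      apply hne
      rw [← hΩre, hκ]
      simp
    · rw [← hΩre, hκ, hw j hj]; push_cast; ring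
  choose! κ hκ0 hκΩ using hκ
  -- (5) quasi-period transport along the dual multiplier `βⱼ = Nⱼ/αⱼ : Λⱼ → Λ₀`
  have hH : ∀ j ∈ S, ∃ (N' : ℕ) (s : ℂ), 0 < N' ∧ IsAlgebraic ℚ s ∧
      (N' : ℂ) * ((a j : ℂ) * (L j).η₁ + (b j : ℂ) * (L j).η₂) =
        ((κ j * m j ^ 2 : ℤ) : ℂ) / (x j : ℂ) * G j -
          s * ((a j : ℂ) * (L j).ω₁ + (b j : ℂ) * (L j).ω₂) := by
    intro j hj
    have hNc : (N j : ℂ) ≠ 0 := by exact_mod_cast hN j hj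
    have htc : (t j : ℂ) ≠ 0 := by exact_mod_cast ht j hj
    have hmc : (m j : ℂ) ≠ 0 := by exact_mod_cast hm0 j hj
    set β : ℂ := (N j : ℂ) * (α j)⁻¹ with hβ
    have hβ0 : β ≠ 0 := mul_ne_zero hNc (inv_ne_zero (hα0 j hj))
    have hβL : ∀ l ∈ (L j).lattice, β * l ∈ L₀.lattice := fun l hl => by
      rw [hβ, mul_assoc]
      exact hNL j hj l hl
    obtain ⟨P, Q, hPQ⟩ := PeriodPair.mem_lattice.1 (hβL _ (L j).ω₁_mem_lattice)
    obtain ⟨U, V, hUV⟩ := PeriodPair.mem_lattice.1 (hβL _ (L j).ω₂_mem_lattice)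
    obtain ⟨N', s, hN', hs, hη₁, hη₂⟩ :=
      IsotypicSplitting.quasiPeriod_transport hβ0 hβL (hLalg j hj).1 (hLalg j hj).2 hPQ hUV
    refine ⟨N', s, hN', hs, ?_⟩
    have hβΩ : β * ((a j : ℂ) * (L j).ω₁ + (b j : ℂ) * (L j).ω₂) =
        ((a j * P + b j * U : ℤ) : ℂ) * L₀.ω₁ + ((a j * Q + b j * V : ℤ) : ℂ) * L₀.ω₂ := by
      push_cast
      linear_combination (-(a j : ℂ)) * hPQ - (b j : ℂ) * hUV
    have hNH : (N' : ℂ) * ((a j : ℂ) * (L j).η₁ + (b j : ℂ) * (L j).η₂) =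
        β * (((a j * P + b j * U : ℤ) : ℂ) * L₀.η₁ + ((a j * Q + b j * V : ℤ) : ℂ) * L₀.η₂) -
          s * ((a j : ℂ) * (L j).ω₁ + (b j : ℂ) * (L j).ω₂) := by
      push_cast
      linear_combination (a j : ℂ) * hη₁ + (b j : ℂ) * hη₂
    rw [hNH]
    rcases hcase j hj with ⟨him, hαt, -⟩ | ⟨him, hαt, -⟩
    · -- real type: `βΩⱼ = κⱼmⱼ·u`
      have hβΩ' : β * ((a j : ℂ) * (L j).ω₁ + (b j : ℂ) * (L j).ω₂) =
          ((κ j * m j : ℤ) : ℂ) * (L₀.minRealPeriod : ℂ) := by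
        rw [hκΩ j hj, hg, if_pos him, hx, hβ, hαt]
        push_cast
        field_simp
      obtain ⟨h1, h2⟩ := int_rel_trivial L₀ (s := a j * P + b j * U - κ j * m j * m₁)
        (t := a j * Q + b j * V - κ j * m j * n₁) (by
          push_cast
          push_cast at hβΩ hβΩ'
          linear_combination -hβΩ + hβΩ' - ((κ j : ℂ) * (m j : ℂ)) * e₁)
      have h1' : a j * P + b j * U = κ j * m j * m₁ := by linarith
      have h2' : a j * Q + b j * V = κ j * m j * n₁ := by linarith
      rw [h1', h2', hG, if_pos him, hx, hβ, hαt]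
      push_cast
      field_simp
    · -- imaginary type: `βΩⱼ = −κⱼmⱼ·iv`
      have hIinv : ((t j : ℂ) * I)⁻¹ = -I * (t j : ℂ)⁻¹ := by
        rw [mul_inv, Complex.inv_I]; ring
      have hβΩ' : β * ((a j : ℂ) * (L j).ω₁ + (b j : ℂ) * (L j).ω₂) =
          -((κ j * m j : ℤ) : ℂ) * (I * ((L₀.mulLeft I I_ne_zero).minRealPeriod : ℂ)) := by
        rw [hκΩ j hj, hg, if_neg him, hx, hβ, hαt, hIinv]
        push_cast
        field_simp
      obtain ⟨h1, h2⟩ := int_rel_trivial L₀ (s := a j * P + b j * U + κ j * m j * m₂)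
        (t := a j * Q + b j * V + κ j * m j * n₂) (by
          push_cast
          push_cast at hβΩ hβΩ'
          linear_combination -hβΩ + hβΩ' + ((κ j : ℂ) * (m j : ℂ)) * e₂)
      have h1' : a j * P + b j * U = -(κ j * m j * m₂) := by linarith
      have h2' : a j * Q + b j * V = -(κ j * m j * n₂) := by linarith
      rw [h1', h2', hG, if_neg him, hx, hβ, hαt, hIinv]
      push_cast
      field_simp
      ring
  choose! N' s hN' hs hNH using hH
  -- (6) the brackets
  obtain ⟨Acoef, hA⟩ : ∃ Acoef : Fin k → ℂ, ∀ j,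
      Acoef j = ((p j : ℂ) - (q j : ℂ) * s j / (N' j : ℂ)) * (κ j : ℂ) * (x j : ℂ) :=
    ⟨_, fun j => rfl⟩
  obtain ⟨c, hc⟩ : ∃ c : Fin k → ℚ, ∀ j, c j = q j * κ j * m j ^ 2 / N' j := ⟨_, fun j => rfl⟩
  have hterm : ∀ j ∈ S, (p j : ℂ) * ((a j : ℂ) * (L j).ω₁ + (b j : ℂ) * (L j).ω₂) +
      (q j : ℂ) * ((a j : ℂ) * (L j).η₁ + (b j : ℂ) * (L j).η₂) =
      Acoef j * (g j : ℂ) + (((c j : ℝ) * (x j)⁻¹ : ℝ) : ℂ) * G j := by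
    intro j hj
    have hN'c : (N' j : ℂ) ≠ 0 := by exact_mod_cast (hN' j hj).ne'
    have hxc : (x j : ℂ) ≠ 0 := by exact_mod_cast (hxpos j hj).ne'
    have hHj : (a j : ℂ) * (L j).η₁ + (b j : ℂ) * (L j).η₂ =
        (N' j : ℂ)⁻¹ * (((κ j * m j ^ 2 : ℤ) : ℂ) / (x j : ℂ) * G j -
          s j * ((a j : ℂ) * (L j).ω₁ + (b j : ℂ) * (L j).ω₂)) := by
      rw [← hNH j hj, inv_mul_cancel_left₀ hN'c]
    rw [hHj, hκΩ j hj, hA, hc]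
    push_cast
    field_simp
    ring
  have hsum' : ∑ j ∈ S, (Acoef j * (g j : ℂ) + (((c j : ℝ) * (x j)⁻¹ : ℝ) : ℂ) * G j) = 0 := by
    rw [← hsum]
    exact Finset.sum_congr rfl fun j hj => (hterm j hj).symm
  set Sre := S.filter (fun j => (α j).im = 0) with hSre
  set Sim := S.filter (fun j => ¬ (α j).im = 0) with hSim
  have hsplit : (∑ j ∈ Sre, Acoef j) * (L₀.minRealPeriod : ℂ) +
      (∑ j ∈ Sim, Acoef j) * ((L₀.mulLeft I I_ne_zero).minRealPeriod : ℂ) +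
      (((∑ j ∈ Sre, (c j : ℝ) * (x j)⁻¹ : ℝ) : ℂ)) * ((m₁ : ℂ) * L₀.η₁ + n₁ * L₀.η₂) +
      (((∑ j ∈ Sim, (c j : ℝ) * (x j)⁻¹ : ℝ) : ℂ)) * (I * ((m₂ : ℂ) * L₀.η₁ + n₂ * L₀.η₂)) = 0 := by
    rw [← hsum', ← Finset.sum_filter_add_sum_filter_not S (fun j => (α j).im = 0)]
    have hre : ∑ j ∈ Sre, (Acoef j * (g j : ℂ) + (((c j : ℝ) * (x j)⁻¹ : ℝ) : ℂ) * G j) =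
        (∑ j ∈ Sre, Acoef j) * (L₀.minRealPeriod : ℂ) +
        (((∑ j ∈ Sre, (c j : ℝ) * (x j)⁻¹ : ℝ) : ℂ)) * ((m₁ : ℂ) * L₀.η₁ + n₁ * L₀.η₂) := by
      rw [Finset.sum_add_distrib, Finset.sum_mul, ofReal_sum, Finset.sum_mul]
      congr 1
      · refine Finset.sum_congr rfl fun j hj => ?_
        rw [hg, if_pos (Finset.mem_filter.1 hj).2]
      · refine Finset.sum_congr rfl fun j hj => ?_
        rw [hG, if_pos (Finset.mem_filter.1 hj).2]
    have him : ∑ j ∈ Sim, (Acoef j * (g j : ℂ) + (((c j : ℝ) * (x j)⁻¹ : ℝ) : ℂ) * G j) =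
        (∑ j ∈ Sim, Acoef j) * ((L₀.mulLeft I I_ne_zero).minRealPeriod : ℂ) +
        (((∑ j ∈ Sim, (c j : ℝ) * (x j)⁻¹ : ℝ) : ℂ)) * (I * ((m₂ : ℂ) * L₀.η₁ + n₂ * L₀.η₂)) := by
      rw [Finset.sum_add_distrib, Finset.sum_mul, ofReal_sum, Finset.sum_mul]
      congr 1
      · refine Finset.sum_congr rfl fun j hj => ?_
        rw [hg, if_neg (Finset.mem_filter.1 hj).2]
      · refine Finset.sum_congr rfl fun j hj => ?_
        rw [hG, if_neg (Finset.mem_filter.1 hj).2]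
    rw [← hSre, ← hSim, hre, him]
    ring
  -- (7) Masser: the four brackets vanish
  have hsalg : ∀ j ∈ S, IsAlgebraic ℚ (Acoef j) := by
    intro j hj
    rw [hA]
    exact ((((isAlgebraic_algebraMap (p j)).sub
      (((isAlgebraic_algebraMap (q j)).mul (hs j hj)).mul (isAlgebraic_nat (N' j)).inv)).mul
      (isAlgebraic_int (κ j))).mul (hxalg j hj))
  have hAalg : ∀ T : Finset (Fin k), T ⊆ S → IsAlgebraic ℚ (∑ j ∈ T, Acoef j) := by
    intro T hTS
    exact (Subalgebra.algebraicClosure ℚ ℂ).sum_mem fun j hj =>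
      (hsalg j (hTS hj) : Acoef j ∈ Subalgebra.algebraicClosure ℚ ℂ)
  have hxinvalg : ∀ j ∈ S, IsAlgebraic ℚ (((x j)⁻¹ : ℝ) : ℂ) := by
    intro j hj
    rw [ofReal_inv]
    exact (hxalg j hj).inv
  have hCalg : ∀ T : Finset (Fin k), T ⊆ S →
      IsAlgebraic ℚ (((∑ j ∈ T, (c j : ℝ) * (x j)⁻¹ : ℝ) : ℂ)) := by
    intro T hTS
    push_cast
    exact (Subalgebra.algebraicClosure ℚ ℂ).sum_mem fun j hj =>
      ((isAlgebraic_algebraMap (c j)).mul (by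
        have := hxinvalg j (hTS hj); rwa [ofReal_inv] at this) :
        (c j : ℂ) * ((x j : ℂ))⁻¹ ∈ Subalgebra.algebraicClosure ℚ ℂ)
  obtain ⟨hA0, hB0, hC0, hD0⟩ := indep_four hg₂ hg₃ hCM hreal₀ e₁ e₂
    (hAalg _ (Finset.filter_subset _ _)) (hAalg _ (Finset.filter_subset _ _))
    (hCalg _ (Finset.filter_subset _ _)) (hCalg _ (Finset.filter_subset _ _)) hsplit
  -- (8) the `η`-brackets: `qⱼ = 0`
  have hC0' : ∑ j ∈ Sre, (c j : ℝ) * (x j)⁻¹ = 0 := by exact_mod_cast hC0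
  have hD0' : ∑ j ∈ Sim, (c j : ℝ) * (x j)⁻¹ = 0 := by exact_mod_cast hD0
  have hinvpos : ∀ j ∈ S, 0 < (x j)⁻¹ := fun j hj => inv_pos.2 (hxpos j hj)
  have hinvsq : ∀ j ∈ S, ∃ a' : ℚ, (x j)⁻¹ ^ 2 = (a' : ℝ) := fun j hj => by
    obtain ⟨a', ha'⟩ := hxsq j hj
    exact ⟨a'⁻¹, by rw [inv_pow, ha']; push_cast; ring⟩
  have hirr_inv : ∀ T : Finset (Fin k), T ⊆ S → (∀ j ∈ T, ∀ j' ∈ T, ((α j).im = 0 ↔ (α j').im = 0)) →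
      ∀ j ∈ T, ∀ j' ∈ T, j ≠ j' → ¬ ∃ r : ℚ, (x j)⁻¹ = (r : ℝ) * (x j')⁻¹ := by
    rintro T hTS hT j hj j' hj' hne ⟨r, hr⟩
    have hxj : x j ≠ 0 := (hxpos j (hTS hj)).ne'
    have hxj' : x j' ≠ 0 := (hxpos j' (hTS hj')).ne'
    have hr0 : r ≠ 0 := by
      rintro rfl
      rw [Rat.cast_zero, zero_mul] at hr
      exact inv_ne_zero hxj hr
    refine hirr j' (hTS hj') j (hTS hj) hne.symm ((hT j hj j' hj').symm) ⟨r, ?_⟩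
    field_simp at hr
    have : x j' = r * x j := by
      have := hr
      field_simp
      linarith
    exact this
  have hq_of : ∀ T : Finset (Fin k), T ⊆ S → (∀ j ∈ T, ∀ j' ∈ T, ((α j).im = 0 ↔ (α j').im = 0)) →
      ∑ j ∈ T, (c j : ℝ) * (x j)⁻¹ = 0 → ∀ j ∈ T, q j = 0 := by
    intro T hTS hT hT0 j hj
    have hcj := radical_indep_finset k T (fun j => (x j)⁻¹) c (fun j hj => hinvpos j (hTS hj))
      (fun j hj => hinvsq j (hTS hj)) (hirr_inv T hTS hT) hT0 j hj
    rw [hc] at hcj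
    have hκj : (κ j : ℚ) ≠ 0 := by exact_mod_cast hκ0 j (hTS hj)
    have hmj : (m j : ℚ) ≠ 0 := by exact_mod_cast hm0 j (hTS hj)
    have hN'j : (N' j : ℚ) ≠ 0 := by exact_mod_cast (hN' j (hTS hj)).ne'
    field_simp at hcj
    simpa [hκj, hmj] using hcj
  have hTre : ∀ j ∈ Sre, ∀ j' ∈ Sre, ((α j).im = 0 ↔ (α j').im = 0) := fun j hj j' hj' =>
    ⟨fun _ => (Finset.mem_filter.1 hj').2, fun _ => (Finset.mem_filter.1 hj).2⟩
  have hTim : ∀ j ∈ Sim, ∀ j' ∈ Sim, ((α j).im = 0 ↔ (α j').im = 0) := fun j hj j' hj' =>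
    ⟨fun h => absurd h (Finset.mem_filter.1 hj).2, fun h => absurd h (Finset.mem_filter.1 hj').2⟩
  have hq0 : ∀ j ∈ S, q j = 0 := by
    intro j hj
    by_cases hp : (α j).im = 0
    · exact hq_of Sre (Finset.filter_subset _ _) hTre hC0' j (Finset.mem_filter.2 ⟨hj, hp⟩)
    · exact hq_of Sim (Finset.filter_subset _ _) hTim hD0' j (Finset.mem_filter.2 ⟨hj, hp⟩)
  -- (9) the `ω`-brackets: `pⱼ = 0`
  obtain ⟨c', hc'⟩ : ∃ c' : Fin k → ℚ, ∀ j, c' j = p j * κ j := ⟨_, fun j => rfl⟩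
  have hA' : ∀ j ∈ S, Acoef j = (((c' j : ℝ) * x j : ℝ) : ℂ) := by
    intro j hj
    rw [hA, hq0 j hj, hc']
    push_cast
    ring
  have hp_of : ∀ T : Finset (Fin k), T ⊆ S → (∀ j ∈ T, ∀ j' ∈ T, ((α j).im = 0 ↔ (α j').im = 0)) →
      ∑ j ∈ T, Acoef j = 0 → ∀ j ∈ T, p j = 0 := by
    intro T hTS hT hT0 j hj
    have hT0' : ∑ j ∈ T, (c' j : ℝ) * x j = 0 := by
      have : ((∑ j ∈ T, (c' j : ℝ) * x j : ℝ) : ℂ) = 0 := by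
        rw [ofReal_sum, ← hT0]
        exact Finset.sum_congr rfl fun j hj => (hA' j (hTS hj)).symm
      exact_mod_cast this
    have hcj := radical_indep_finset k T x c' (fun j hj => hxpos j (hTS hj))
      (fun j hj => hxsq j (hTS hj))
      (fun j hj j' hj' hne => hirr j (hTS hj) j' (hTS hj') hne (hT j hj j' hj')) hT0' j hj
    rw [hc'] at hcj
    have hκj : (κ j : ℚ) ≠ 0 := by exact_mod_cast hκ0 j (hTS hj)
    simpa [hκj] using hcj
  intro j hj
  refine ⟨?_, hq0 j hj⟩
  by_cases hp : (α j).im = 0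
  · exact hp_of Sre (Finset.filter_subset _ _) hTre hA0 j (Finset.mem_filter.2 ⟨hj, hp⟩)
  · exact hp_of Sim (Finset.filter_subset _ _) hTim hB0 j (Finset.mem_filter.2 ⟨hj, hp⟩)

/-- **Class independence from its CM case.** Hypothesis (2) of `stub_etaIndependence_of` (class
independence for pairwise isogenous lattices with rational invariants and pairwise without
rational multiplier) follows from its restriction to classes ALL of whose lattices have complex
multiplication: if some `Λ_{i₀}` of the class has no CM, `classIndependence_nonCM` applies.
[cite: Masser1975, Ch. II Thm. II and Ch. III Thm. III] -/
theorem classIndependence_of_cm : (∀ (k : ℕ) (S : Finset (Fin k)) (L : Fin k → PeriodPair) (a b : Fin k → ℤ) (p q : Fin k → ℚ), (∀ j ∈ S, (L j).HasCM) → (∀ j ∈ S, (∃ r : ℚ, (r : ℂ) = (L j).g₂) ∧ (∃ r : ℚ, (r : ℂ) = (L j).g₃)) → (∀ j ∈ S, ((a j : ℂ) * (L j).ω₁ + (b j : ℂ) * (L j).ω₂).im = 0 ∧ (a j : ℂ) * (L j).ω₁ + (b j : ℂ) * (L j).ω₂ ≠ 0) → (∀ i ∈ S, ∀ j ∈ S,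 (L i).IsIsogenousTo (L j)) → (∀ i ∈ S, ∀ j ∈ S, i ≠ j → ¬ ∃ c : ℚ, c ≠ 0 ∧ ∀ l ∈ (L i).lattice, (c : ℂ) * l ∈ (L j).lattice) → ∑ j ∈ S, ((p j : ℂ) * ((a j : ℂ) * (L j).ω₁ + (b j : ℂ) * (L j).ω₂) + (q j : ℂ) * ((a j : ℂ) * (L j).η₁ + (b j : ℂ) * (L j).η₂)) = 0 → ∀ j ∈ S, p j = 0 ∧ q j = 0) → ∀ (k : ℕ) (S : Finset (Fin k)) (L : Fin k → PeriodPair) (a b : Fin k → ℤ) (p q : Fin k → ℚ), (∀ j ∈ S, (∃ r : ℚ, (r : ℂ) = (L j).g₂) ∧ (∃ r : ℚ, (r : ℂ) = (L j).g₃)) → (∀ j ∈ S, ((a j : ℂ) * (L j).ω₁ + (b j : ℂ) * (L j).ω₂).im = 0 ∧ (a j : ℂ) * (L j).ω₁ + (b j : ℂ) * (L j).ω₂ ≠ 0) → (∀ i ∈ S, ∀ j ∈ S, (L i).IsIsogenousTo (L j)) → (∀ i ∈ S, ∀ j ∈ S, i ≠ j → ¬ ∃ c : ℚ, c ≠ 0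 ∧ ∀ l ∈ (L i).lattice, (c : ℂ) * l ∈ (L j).lattice) → ∑ j ∈ S, ((p j : ℂ) * ((a j : ℂ) * (L j).ω₁ + (b j : ℂ) * (L j).ω₂) + (q j : ℂ) * ((a j : ℂ) * (L j).η₁ + (b j : ℂ) * (L j).η₂)) = 0 → ∀ j ∈ S, p j = 0 ∧ q j = 0 := by
  intro hCMcase k S L a b p q hrat hper hiso hnrm hsum
  by_cases hall : ∀ j ∈ S, (L j).HasCM
  · exact hCMcase k S L a b p q hall hrat hper hiso hnrm hsum
  · push Not at hall
    obtain ⟨i₀, hi₀, hCM⟩ := hall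
    exact classIndependence_nonCM k S L a b p q i₀ hi₀ hCM hrat hper hiso hnrm hsum

end Summit.KontsevichZagierPeriods.IsogenyCertificates.XMapKernelStubs.EtaIndependence

end
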